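import Mathlib
import Literature.Computability.AlgebraicComplexity.StandardFamilies
import Summits.ValiantsHypothesis.ValiantsHypothesis.Theses.RefutationDegree
import Summits.ValiantsHypothesis.ValiantsHypothesis.Theorems.RefutationDegreeDefs

/-!
# Crux `RefutationBarrier` (stmt-ValiantsHypothesis-5642), line Sketch-ideator1, stub `stub_hasSosRef_of_hasNsRef`

NULLSTELLENSATZ ⟹ HERMITIAN SOS, SAME DEGREE (the general form of the route's support item
`NsToSos`, `D_SOS ≤ D_NS`).  From a Nullstellensatz refutation `Σ_{μ ∈ supp P} h_μ · P.coeff μ = 1`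
of Rep(n,m) with every product of total degree `≤ D` we build the Hermitian-SOS refutation with NO
squares (`k = 0`) and multipliers `h'_μ := -(1/2) · rename Sum.inl (h_μ)` (the holomorphic lift):
`Σ_μ h'_μ · eqn_μ = -(1/2) · rename inl (Σ_μ h_μ · P.coeff μ) = C (-1/2)`, and the conjugation
`cj = rename swap ∘ map conj` is additive and fixes the real constant `-1/2`, so the identity reads
`0 + (C (-1/2) + C (-1/2)) + 1 = 0`.  Degrees do not increase (`totalDegree_rename_le`, and
multiplying by a constant does not raise the total degree).  The corollary `nsToSos_proof` is the
route item `NsToSos` verbatim (it unfolds to `∀ n m d, HasNsRef n m d → HasSosRef n m d`).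

References: Krajíček, *Proof Complexity* (CUP 2019) §6.4 ("the Positivstellensatz system is the
NS version of the semialgebraic calculus"); Grigoriev 2001 (Positivstellensatz degree);
Buss–Impagliazzo–Krajíček–Pudlák–Razborov–Sgall 1997 (Nullstellensatz degree).  The vocabulary
(`Unk`, `defect`, `eqn`, `cj`, `HasNsRef`, `HasSosRef`) is the route's, from
`Theorems/RefutationDegreeDefs.lean`.
-/

-- `Summit.ValiantsHypothesis.ValiantsHypothesis.…` is the tree's mandated single-conjunct layout
-- (Sub = Summit), so the duplicated namespace component is intended.
set_option linter.dupNamespace false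

noncomputable section

namespace Summit.ValiantsHypothesis.ValiantsHypothesis.Theorems.RefutationDegree

open scoped BigOperators
open Filter Topology MvPolynomial
open Literature.Computability.AlgebraicComplexity (perPoly)
open Summit.ValiantsHypothesis.ValiantsHypothesis.Theses.RefutationDegree

/-- `cj` is additive: it commutes with finite sums (it is `rename swap ∘ map conj`, a composition of
ring homomorphisms). [folklore] -/
private theorem cj_finsetSum_aux {σ ι : Type*} (s : Finset ι) (f : ι → MvPolynomial (σ ⊕ σ) ℂ) :
    cj σ (∑ i ∈ s, f i) = ∑ i ∈ s, cj σ (f i) := by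
  simp only [cj, map_sum]

/-- `cj` conjugates constants: `cj (C c) = C (conj c)`. [folklore] -/
private theorem cj_C_aux {σ : Type*} (c : ℂ) :
    cj σ (C c : MvPolynomial (σ ⊕ σ) ℂ) = C (starRingEnd ℂ c) := by
  unfold cj
  rw [map_C, rename_C]

/-- NsToSos (general form of the route's support item `NsToSos`): a Nullstellensatz refutation of
Rep(n,m) of degree `D` is a Hermitian-SOS refutation of degree `D` — take `k = 0` squares and
`h'_μ := -(1/2) · rename Sum.inl (h_μ)`; `cj` is additive and fixes the real constant `-1/2`, and
`deg (C (-1/2) · rename inl (h_μ · P.coeff μ)) ≤ deg (h_μ · P.coeff μ) ≤ D`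
(Krajíček, *Proof Complexity* §6.4: `D_SOS ≤ D_NS`). -/
theorem stub_hasSosRef_of_hasNsRef (n m D : ℕ) : HasNsRef n m D → HasSosRef n m D := by
  rintro ⟨h, hh, hsum⟩
  -- the multipliers `h'_μ = -(1/2) · (h_μ lifted to the holomorphic copy)` and their products
  obtain ⟨g, hg⟩ : ∃ g : ((Fin n × Fin n) →₀ ℕ) → MvPolynomial (Unk n m ⊕ Unk n m) ℂ,
      ∀ μ, g μ * eqn n m μ = C (-(1 / 2 : ℂ)) * rename Sum.inl (h μ * (defect n m).coeff μ) :=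
    ⟨fun μ => C (-(1 / 2 : ℂ)) * rename Sum.inl (h μ), fun μ => by
      rw [eqn, mul_assoc, ← map_mul]⟩
  -- `conj (-1/2) = -1/2`
  have hc : (starRingEnd ℂ) (-(1 / 2 : ℂ)) = -(1 / 2 : ℂ) := by
    rw [map_neg, map_div₀, map_one, map_ofNat]
  -- `Σ_μ h'_μ · eqn_μ = -(1/2) · rename inl (Σ_μ h_μ · P.coeff μ) = C (-1/2)`
  have hlift : ∑ μ ∈ (defect n m).support, g μ * eqn n m μ = C (-(1 / 2 : ℂ)) := by
    simp only [hg]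
    rw [← Finset.mul_sum, ← map_sum, hsum, map_one, mul_one]
  -- `Σ_μ cj (h'_μ · eqn_μ) = cj (C (-1/2)) = C (-1/2)`
  have hconj : ∑ μ ∈ (defect n m).support, cj (Unk n m) (g μ * eqn n m μ) = C (-(1 / 2 : ℂ)) := by
    rw [← cj_finsetSum_aux, hlift, cj_C_aux, hc]
  refine ⟨0, Fin.elim0, g, fun i => i.elim0, fun μ => ?_, ?_⟩
  · -- degrees: `deg (C (-1/2) · rename inl (h_μ · P_μ)) ≤ 0 + deg (h_μ · P_μ) ≤ D`
    rw [hg]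
    refine (totalDegree_mul _ _).trans ?_
    rw [totalDegree_C, zero_add]
    exact (totalDegree_rename_le _ _).trans (hh μ)
  · -- the identity: `0 + (C (-1/2) + C (-1/2)) + 1 = 0`
    rw [Finset.sum_add_distrib, hlift, hconj]
    simp only [Finset.univ_eq_empty, Finset.sum_empty, zero_add]
    rw [← C_add, ← C_1, ← C_add]
    norm_num

/-- The route's support item `NsToSos` (stmt-ValiantsHypothesis-5646) verbatim: it unfolds
definitionally to `∀ n m d, HasNsRef n m d → HasSosRef n m d` (cf. `nsToSos_iff`), which is
`stub_hasSosRef_of_hasNsRef`. -/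
theorem nsToSos_proof : NsToSos := fun n m d => stub_hasSosRef_of_hasNsRef n m d

end Summit.ValiantsHypothesis.ValiantsHypothesis.Theorems.RefutationDegree

end
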